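/-
Copyright (c) 2026 the pub-hodgecm-mathlib formalisation cell (harness21).  Prover seat hodgecm-mathlib-LH4-p04 (g2), req620 Track A «(D-RAM) FOUR-FRAME» squad
(MS ROAD A, STAGE B brick B3 of LH4-p10 (g2) `SPEC-StageB.v1` §B ∕ B10 skeleton v1 — part 3: AXIS VECTORS EXIST, ARE BOUNDED AND UNIQUE (B3-α, B3-β)).  2026-09-04.
-/
import Summits.HodgeConjecture.HodgeConjecture.Theorems.F0P3cDyRamDiagonalStrataDefs   -- ★ DEFS LEAF p855793 (LH4-p10): `HasAxis`, `stratum`; brings ★ TorusDefs (`normalisedStableLattices`)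
import Summits.HodgeConjecture.HodgeConjecture.Theorems.F0P3cDyRamDiagonalBigTube      -- ★ p855091∕p855162 (LH4-p11): `smul_single_mem_of_mapGL_diagonal_le` (Lagrange: `μᵢ·xᵢ·eᵢ ∈ M`)
import Literature.NumberTheory.Automorphic.UnitaryThreeFourFrameDefs                   -- ★ `IsRamifiedQuadraticDatum`, `IsElementDatum`
import HarnessLib

/-!
# Crux `H413`, line LH4 «(D-RAM) FOUR-FRAME» road — unit U3_Laws (iii), MS ROAD A, STAGE B brick B3 (part 3): AXIS VECTORS — every normalised `T`-stable lattice has a unique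
# axis vector `a(M)` (`M ∩ K·eᵢ = 𝔭^{aᵢ}eᵢ`), with `aᵢ ≤ n₁ + n₂ + n₃` (B10 skeleton stubs `stub_B3_axis`, `stub_B3_axis_unique`)

Cell `hodgecm-mathlib` (D-0151), FLOOR 0, crux item H413 = `stmt-HodgeConjecture-24833`, route of record `HCCMUnconditional`; squad F0∕P3c∕LH4 (req618∕req620); registered stub served:
`F0P3cDyRamFourFrameU3.stub_U3_stableModelSum` (MS).  THEOREMS ONLY (no `def`, no instance, no notation, no `sorry`, default heartbeats); lane
`--supports stmt-HodgeConjecture-24833 --as helper` (count-neutral).  STAGE B assembly B10 (LH4-p10 (g2) `B10-StableCountTypeZero.SKELETON.v1`, ★ DEFS LEAF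
`F0P3cDyRamDiagonalStrataDefs`: `HasAxis ϖ M a := ∀ i t, t·eᵢ ∈ M ↔ |t| ≤ |ϖ|^{aᵢ}`, `stratum σ ϖ T a`) partitions the dualisable part of `𝓛₀(T)` by axis vector; this file
supplies the two structural stubs of that partition, B3-α (existence + the bound `aᵢ ≤ n₁+n₂+n₃`, so the partition is FINITE) and B3-β (uniqueness, so the strata are DISJOINT).

THE MATHEMATICS.  (β) If `a` and `a′` are axis vectors of `M`, then `ϖ^{aᵢ}eᵢ ∈ M` gives `|ϖ^{aᵢ}| ≤ |ϖ|^{a′ᵢ}`, i.e. `a′ᵢ ≤ aᵢ`, and symmetrically.  (α) For `M ∈ 𝓛₀(T)`,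
`T = diag(α, β, 1)` with the element datum `(α, β; n₁, n₂, n₃)`: the slot set `Sᵢ = {t : t·eᵢ ∈ M}` is an `𝒪`-submodule of `𝒪` (normalisation: `|wᵢ| ≤ 1` on `M`), SATURATED
(`t·eᵢ = (t∕t₁)·(t₁eᵢ)`), and contains the Lagrange element `μᵢ·xᵢ` for any `x ∈ M` (★ `smul_single_mem_of_mapGL_diagonal_le`: `μᵢ = (sᵢ − sⱼ)(sᵢ − sₖ)`), where we take
`|xᵢ| = 1` (normalisation) so that `|μᵢxᵢ| = |ϖ|^{nⱼ′ + nₖ′}` is a power of `|ϖ|` with exponent `≤ n₁ + n₂ + n₃` (`|α − β| = |ϖ|^{n₃}`, `|α − 1| = |ϖ|^{n₂}`, `|β − 1| = |ϖ|^{n₁}`);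
hence `Sᵢ = {t : |t| ≤ |ϖ|^{aᵢ}}` with `aᵢ` = the least exponent attained in `Sᵢ` (`exists_axis_exponent`), and `aᵢ ≤ nⱼ′ + nₖ′ ≤ n₁ + n₂ + n₃`.

WHAT IS PROVED.  §1 `hasAxis_unique` (B3-β, generic `N`).  §2 `single_mem_of_v_le` (saturation), `exists_axis_exponent` (one slot, generic `N`), HEAD `exists_hasAxis` (B3-α:
`∃ a, HasAxis ϖ M a ∧ ∀ i, a i ≤ n₁ + n₂ + n₃` for `M ∈ normalisedStableLattices T`, `T = diag(α, β, 1)`, under the ramified quadratic datum and the element datum).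
HONEST LABEL.  Count-neutral (`--supports`); nothing printed is asserted; (MS) stays a PROVER TARGET (empirical census law — LH4-p10 MEMO v2 is its paper proof); `HC_CM` is proved only
modulo the 7 printed citations (2 remaining named inputs: hLiu418 = `stmt-HodgeConjecture-24832`, h413 = `stmt-HodgeConjecture-24833`) until rung 0 closes.

## References
* [Kottwitz1986BaseChangeUnits] R. E. Kottwitz, *Base change for unit elements of Hecke algebras*, Compositio Math. 60 (1986), §1 pp. 240–241 (fixed lattices counted by position
  relative to the torus; the Lagrange box).
* [Serre1980Trees] J.-P. Serre, *Trees*, Springer (1980), Ch. II §1.1 (lattices and their coordinate axes).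
* [BruhatTits1972] F. Bruhat, J. Tits, *Groupes réductifs sur un corps local I*, Publ. Math. IHÉS 41 (1972), §10 (apartments: distance to the splitting sub-buildings).
-/

set_option autoImplicit false

noncomputable section

namespace Summit.HodgeConjecture.HodgeConjecture.Cruxes.H413.F0P3cDyRamDiagonalStrataAxis

open Matrix
open Literature.NumberTheory.Automorphic Literature.NumberTheory.Automorphic.HermitianLattice
open Literature.NumberTheory.Automorphic.UnitaryLatticeTree Literature.NumberTheory.Automorphic.UnitaryThreeFourFrame
open Summit.HodgeConjecture.HodgeConjecture.Cruxes.H413.F0P3cDyRamDiagonalTorusDefs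
open Summit.HodgeConjecture.HodgeConjecture.Cruxes.H413.F0P3cDyRamDiagonalStrataDefs
open Summit.HodgeConjecture.HodgeConjecture.Cruxes.H413.F0P3cDyRamDiagonalBigTube
open scoped Valued WithZero Matrix MatrixGroups

variable {K : Type*} [Field K] [Valued K ℤᵐ⁰] {N : ℕ}

/-! ## §1  B3-β: axis vectors are unique -/

/-- **B3-β · AXIS VECTORS ARE UNIQUE**: if `t·eᵢ ∈ M ↔ |t| ≤ |ϖ|^{aᵢ}` and also `↔ |t| ≤ |ϖ|^{a′ᵢ}` for all `i, t` (`|ϖ| = exp(−1)`), then `a = a′` — test with `t = ϖ^{aᵢ}` and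
`t = ϖ^{a′ᵢ}`.  So the strata `stratum σ ϖ T a` of ★ `F0P3cDyRamDiagonalStrataDefs` are pairwise disjoint. [cite: Serre1980Trees, II §1.1] -/
theorem hasAxis_unique {ϖ : K} (hϖ : Valued.v ϖ = WithZero.exp (-1 : ℤ)) {M : Submodule 𝒪[K] (Fin N → K)} {a a' : Fin N → ℕ}
    (ha : HasAxis ϖ M a) (ha' : HasAxis ϖ M a') : a = a' := by
  have hq : ∀ n : ℕ, Valued.v ϖ ^ n = WithZero.exp (-(n : ℤ)) := fun n => by
    rw [hϖ, ← WithZero.exp_nsmul]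
    congr 1
    simp
  have key : ∀ {a a' : Fin N → ℕ}, HasAxis ϖ M a → HasAxis ϖ M a' → ∀ i, a' i ≤ a i := by
    intro a a' ha ha' i
    have h1 : (Pi.single i (ϖ ^ a i) : Fin N → K) ∈ M := (ha i _).2 (by rw [map_pow])
    have h2 := (ha' i _).1 h1
    rw [map_pow, hq, hq, WithZero.exp_le_exp] at h2
    omega
  funext i
  exact le_antisymm (key ha' ha i) (key ha ha' i)

/-! ## §2  B3-α: axis vectors exist and are bounded by `n₁ + n₂ + n₃` -/

/-- **SATURATION OF A SLOT**: if `t₁·eᵢ ∈ M` (`t₁ ≠ 0`) and `|t| ≤ |t₁|`, then `t·eᵢ = (t∕t₁)·(t₁·eᵢ) ∈ M`. [cite: Serre1980Trees, II §1.1] -/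
theorem single_mem_of_v_le (M : Submodule 𝒪[K] (Fin N → K)) (i : Fin N) {t₁ t : K} (h₁ : (Pi.single i t₁ : Fin N → K) ∈ M) (ht₁ : t₁ ≠ 0)
    (hle : Valued.v t ≤ Valued.v t₁) : (Pi.single i t : Fin N → K) ∈ M := by
  have hc : Valued.v (t / t₁) ≤ 1 := by
    rw [map_div₀]; exact (div_le_one₀ ((Valuation.pos_iff _).2 ht₁)).2 hle
  have h := M.smul_mem (⟨t / t₁, (Valuation.mem_integer_iff _ _).2 hc⟩ : 𝒪[K]) h₁
  have heq : ((⟨t / t₁, (Valuation.mem_integer_iff _ _).2 hc⟩ : 𝒪[K]) • (Pi.single i t₁ : Fin N → K)) = Pi.single i t := by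
    change (t / t₁) • (Pi.single i t₁ : Fin N → K) = Pi.single i t
    rw [← Pi.single_smul', smul_eq_mul, div_mul_cancel₀ _ ht₁]
  rwa [heq] at h

/-- **ONE SLOT: THE AXIS EXPONENT EXISTS** (`|ϖ| = exp(−1)`).  If the slot set `Sᵢ = {t : t·eᵢ ∈ M}` is integral (`|t| ≤ 1` on it) and contains some `t₀` with `|t₀| = |ϖ|^m`, then
`Sᵢ = {t : |t| ≤ |ϖ|^e}` for a (unique) `e ≤ m` — the least exponent attained in `Sᵢ` (saturation downward, minimality upward). [cite: Serre1980Trees, II §1.1]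
[cite: BruhatTits1972, §10] -/
theorem exists_axis_exponent {ϖ : K} (hϖ : Valued.v ϖ = WithZero.exp (-1 : ℤ)) (M : Submodule 𝒪[K] (Fin N → K)) (i : Fin N)
    (h1 : ∀ t : K, (Pi.single i t : Fin N → K) ∈ M → Valued.v t ≤ 1) {t₀ : K} {m : ℕ}
    (h0 : (Pi.single i t₀ : Fin N → K) ∈ M) (ht₀ : Valued.v t₀ = Valued.v ϖ ^ m) :
    ∃ e : ℕ, e ≤ m ∧ ∀ t : K, (Pi.single i t : Fin N → K) ∈ M ↔ Valued.v t ≤ Valued.v ϖ ^ e := by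
  classical
  have hq : ∀ n : ℕ, Valued.v ϖ ^ n = WithZero.exp (-(n : ℤ)) := fun n => by
    rw [hϖ, ← WithZero.exp_nsmul]
    congr 1
    simp
  have hP : ∃ n : ℕ, ∃ t : K, (Pi.single i t : Fin N → K) ∈ M ∧ Valued.v t = Valued.v ϖ ^ n := ⟨m, t₀, h0, ht₀⟩
  refine ⟨Nat.find hP, Nat.find_min' hP ⟨t₀, h0, ht₀⟩, fun t => ?_⟩
  obtain ⟨t₁, ht₁M, ht₁v⟩ := Nat.find_spec hP
  have ht₁0 : t₁ ≠ 0 := by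
    intro h
    rw [h, map_zero, hq] at ht₁v
    exact WithZero.exp_ne_zero ht₁v.symm
  constructor
  · intro ht
    by_cases ht0 : t = 0
    · rw [ht0, map_zero]; exact zero_le
    obtain ⟨k, hk⟩ : ∃ k : ℤ, Valued.v t = WithZero.exp k :=
      ⟨WithZero.log (Valued.v t), (WithZero.exp_log ((Valuation.ne_zero_iff _).2 ht0)).symm⟩
    have hk0 : k ≤ 0 := by
      have := h1 t ht
      rw [hk, ← WithZero.exp_zero, WithZero.exp_le_exp] at this
      exact this
    have hn : Valued.v t = Valued.v ϖ ^ k.natAbs := by rw [hk, hq, WithZero.exp_inj]; omega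
    have hle := Nat.find_min' hP ⟨t, ht, hn⟩
    rw [hn, hq, hq, WithZero.exp_le_exp]
    omega
  · intro hle
    exact single_mem_of_v_le M i ht₁M ht₁0 (by rw [ht₁v]; exact hle)

/-- **B3-α · EVERY NORMALISED `T`-STABLE LATTICE HAS A BOUNDED AXIS VECTOR** (B10 skeleton `stub_B3_axis`).  Under the ramified quadratic datum (`|ϖ| = exp(−1)`, `σ`
valuation-preserving) and the element datum `(α, β; n₁, n₂, n₃)` (`α, β` norm-one, `|β − 1| = |ϖ|^{n₁}`, `|α − 1| = |ϖ|^{n₂}`, `|α − β| = |ϖ|^{n₃}`), `T = diag(α, β, 1)`: every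
`M ∈ 𝓛₀(T)` (normalised, `T`-stable lattice) has an axis vector `a` — `t·eᵢ ∈ M ↔ |t| ≤ |ϖ|^{aᵢ}` — with `aᵢ ≤ n₁ + n₂ + n₃`: the slot set contains the Lagrange element
`(sᵢ − sⱼ)(sᵢ − sₖ)·xᵢ` for `x ∈ M` with `|xᵢ| = 1` (★ `smul_single_mem_of_mapGL_diagonal_le`; exponents `n₂+n₃`, `n₁+n₃`, `n₁+n₂`), is integral and saturated
(`exists_axis_exponent`). [cite: Kottwitz1986BaseChangeUnits, §1 pp. 240–241] [cite: BruhatTits1972, §10] [cite: Serre1980Trees, II §1.1] -/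
theorem exists_hasAxis {K : Type} [Field K] [Valued K ℤᵐ⁰] {σ : K →+* K} {ϖ : K} {d t : ℕ} {α β : K} {N₀ n₁ n₂ n₃ : ℕ} {T : GL (Fin 3) K}
    (hD : IsRamifiedQuadraticDatum σ ϖ d t) (hE : IsElementDatum σ ϖ N₀ α β n₁ n₂ n₃) (hT : (T : Matrix (Fin 3) (Fin 3) K) = Matrix.diagonal ![α, β, 1])
    {M : Submodule 𝒪[K] (Fin 3 → K)} (hM : M ∈ normalisedStableLattices T) :
    ∃ a : Fin 3 → ℕ, HasAxis ϖ M a ∧ ∀ i, a i ≤ n₁ + n₂ + n₃ := by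
  obtain ⟨-, hvσ, hϖ, -⟩ := hD
  obtain ⟨hα, hβ, -, -, -, hn₁, hn₂, hn₃, -⟩ := hE
  obtain ⟨-, hTM, hnorm⟩ := hM
  -- `|α| = |β| = 1`
  have hunit : ∀ u : K, u * σ u = 1 → Valued.v u = 1 := fun u hu => by
    have hu0 : u ≠ 0 := fun h => by rw [h, zero_mul] at hu; exact zero_ne_one hu
    obtain ⟨k, hk⟩ : ∃ k : ℤ, Valued.v u = WithZero.exp k :=
      ⟨WithZero.log (Valued.v u), (WithZero.exp_log ((Valuation.ne_zero_iff _).2 hu0)).symm⟩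
    have h := congrArg Valued.v hu
    rw [map_mul, hvσ, map_one, hk, ← WithZero.exp_add, ← WithZero.exp_zero, WithZero.exp_inj] at h
    rw [hk, ← WithZero.exp_zero, WithZero.exp_inj]
    omega
  have hs : ∀ i, Valued.v ((![α, β, 1] : Fin 3 → K) i) ≤ 1 := by
    intro i; fin_cases i
    · exact (hunit α hα).le
    · exact (hunit β hβ).le
    · simp
  -- integrality of the slots (normalisation) and a unit coordinate in each slot
  have h1 : ∀ (i : Fin 3) (t : K), (Pi.single i t : Fin 3 → K) ∈ M → Valued.v t ≤ 1 := fun i t ht => by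
    simpa using (hnorm i).1 _ ht
  -- the Lagrange element of each slot: a power of `|ϖ|` with exponent `≤ n₁ + n₂ + n₃`
  have hLag : ∀ i : Fin 3, ∃ (t₀ : K) (m : ℕ), (Pi.single i t₀ : Fin 3 → K) ∈ M ∧ Valued.v t₀ = Valued.v ϖ ^ m ∧ m ≤ n₁ + n₂ + n₃ := by
    have hL := fun (i j k : Fin 3) (hij : i ≠ j) (hik : i ≠ k) (hjk : j ≠ k) =>
      smul_single_mem_of_mapGL_diagonal_le (![α, β, 1] : Fin 3 → K) hs T hT M hTM.le hij hik hjk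
    have hβα : Valued.v (β - α) = Valued.v ϖ ^ n₃ := by rw [Valuation.map_sub_swap]; exact hn₃
    have h1α : Valued.v (1 - α) = Valued.v ϖ ^ n₂ := by rw [Valuation.map_sub_swap]; exact hn₂
    have h1β : Valued.v (1 - β) = Valued.v ϖ ^ n₁ := by rw [Valuation.map_sub_swap]; exact hn₁
    intro i
    obtain ⟨x, hx, hxi⟩ := (hnorm i).2
    fin_cases i
    · refine ⟨((α - β) * (α - 1)) * x 0, n₃ + n₂, ?_, ?_, by omega⟩
      · have h := hL 0 1 2 (by decide) (by decide) (by decide) x hx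
        rwa [← smul_eq_mul, Pi.single_smul'] 
      · have hxi' : Valued.v (x 0) = 1 := hxi
        rw [map_mul, map_mul, hn₃, hn₂, hxi', mul_one, pow_add]
    · refine ⟨((β - α) * (β - 1)) * x 1, n₃ + n₁, ?_, ?_, by omega⟩
      · have h := hL 1 0 2 (by decide) (by decide) (by decide) x hx
        rwa [← smul_eq_mul, Pi.single_smul']
      · have hxi' : Valued.v (x 1) = 1 := hxi
        rw [map_mul, map_mul, hβα, hn₁, hxi', mul_one, pow_add]
    · refine ⟨((1 - α) * (1 - β)) * x 2, n₂ + n₁, ?_, ?_, by omega⟩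
      · have h := hL 2 0 1 (by decide) (by decide) (by decide) x hx
        rwa [← smul_eq_mul, Pi.single_smul']
      · have hxi' : Valued.v (x 2) = 1 := hxi
        rw [map_mul, map_mul, h1α, h1β, hxi', mul_one, pow_add]
  -- slot by slot
  have hax : ∀ i : Fin 3, ∃ e : ℕ, e ≤ n₁ + n₂ + n₃ ∧ ∀ t : K, (Pi.single i t : Fin 3 → K) ∈ M ↔ Valued.v t ≤ Valued.v ϖ ^ e := fun i => by
    obtain ⟨t₀, m, h0, hv, hm⟩ := hLag i
    obtain ⟨e, he, h⟩ := exists_axis_exponent hϖ M i (h1 i) h0 hv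
    exact ⟨e, he.trans hm, h⟩
  choose e he h using hax
  exact ⟨e, (hasAxis_iff ϖ M e).2 fun i t => h i t, he⟩

end Summit.HodgeConjecture.HodgeConjecture.Cruxes.H413.F0P3cDyRamDiagonalStrataAxis

end
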